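import Literature.RingTheory.CompleteIntersection.FittingCriterionField
import Literature.RingTheory.FittingIdeal.MapSurjective
import Mathlib.RingTheory.Finiteness.Finsupp
import HarnessLib

/-!
# The Fitting-ideal criterion over a field for Noetherian local algebras
# (de Smit–Rubin–Schoof, the Theorem behind Criterion I, field case)

B. de Smit, K. Rubin, R. Schoof, *Criteria for complete intersections* (in: Modular Forms and
Fermat's Last Theorem, Springer 1997), Theorem of the Introduction (p. 344) for `O = k` a field,
isomorphism half: for a (complete) Noetherian local `k`-algebra `R`, a finite local `k`-algebra
`T` with augmentation `π : T → k`, and a surjection `φ : R ↠ T`, if `φ Fit_R(I_R) ≠ 0`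
(`I_R = ker(π ∘ φ)`) then `φ` is an isomorphism (`injective_of_map_fittingIdeal_ne_bot`).

The file `FittingCriterionField` proves this when `R` itself is finite over `k`. The general
case reduces to it (a reduction which also makes the printed completeness of `R` unnecessary):
with `K = ker φ` and `R' = R/𝔪_R K`, the algebra `R'` is finite over `k` (an extension of `T` by
the finite-dimensional `K/𝔪_R K`), `φ` factors through `φ' : R' ↠ T`, the hypothesis passes to
`R'` because `Fit_R(I_R)` maps into `Fit_{R'}(I_{R'})`
(`Literature.RingTheory.FittingIdeal.map_fittingIdeal_le_fittingIdeal_of_map_eq`), and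
injectivity of `φ'` means `K = 𝔪_R K`, whence `K = 0` by Nakayama. Everything here is proved;
no definitions, no named facts.

## References

* B. de Smit, K. Rubin, R. Schoof, *Criteria for complete intersections*, in: Modular Forms and
  Fermat's Last Theorem (Cornell–Silverman–Stevens, eds.), Springer 1997, 343–356: Theorem
  (p. 344), Lemma 3.1 and §3 (pp. 350–351). [DeSmitRubinSchoof1997]
-/

namespace Literature.RingTheory.CompleteIntersection

universe u v w

open IsLocalRing Literature.RingTheory.FittingIdeal

variable {k : Type u} [Field k]

/-- **de Smit–Rubin–Schoof's Fitting-ideal criterion over a field** (the "if" part of the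
Theorem of the Introduction, p. 344, for `O = k` a field, isomorphism half; here for any
Noetherian local `R`, completeness being unnecessary): let `R` be a Noetherian local
`k`-algebra, `T` a `k`-algebra finite over `k` with augmentation `π : T → k`, and `φ : R ↠ T` a
surjection of `k`-algebras, `I_R = ker(π ∘ φ)`. If `φ(Fit_R(I_R)) ≠ 0`, then `φ` is injective
(hence an isomorphism). [cite: DeSmitRubinSchoof1997, Theorem, p. 344 and §3] -/
theorem injective_of_map_fittingIdeal_ne_bot
    {R : Type v} [CommRing R] [Algebra k R] [IsLocalRing R] [IsNoetherianRing R]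
    {T : Type w} [CommRing T] [Algebra k T] [Module.Finite k T] (φ : R →ₐ[k] T) (π : T →ₐ[k] k)
    (hφ : Function.Surjective φ)
    (h : (Module.fittingIdeal R (RingHom.ker (π.comp φ)) 0).map φ ≠ ⊥) :
    Function.Injective φ := by
  classical
  set K : Ideal R := RingHom.ker φ with hK
  set L : Ideal R := maximalIdeal R * K with hL
  have hLK : L ≤ K := Ideal.mul_le_left
  -- `R' = R / 𝔪K` and the factorisation `φ = φ' ∘ mk`
  set R' := R ⧸ L with hR'
  set mk : R →+* R' := Ideal.Quotient.mk L with hmk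
  set φ' : R' →ₐ[k] T := Ideal.Quotient.liftₐ L φ (fun a ha => hLK ha) with hφ'
  have hφ'mk : ∀ a, φ' (mk a) = φ a := fun a => rfl
  have hφ'surj : Function.Surjective φ' := fun t => by
    obtain ⟨a, rfl⟩ := hφ t
    exact ⟨mk a, rfl⟩
  have hLtop : L ≠ ⊤ := fun h =>
    (maximalIdeal.isMaximal R).ne_top (top_le_iff.mp (h ▸ (Ideal.mul_le_right : L ≤ _)))
  haveI : Nontrivial R' := Ideal.Quotient.nontrivial_iff.mpr hLtop
  haveI : IsLocalRing R' := IsLocalRing.of_surjective' mk Ideal.Quotient.mk_surjective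
  -- every `r ∈ R` is a scalar plus an element of `𝔪_R`
  set πR : R →ₐ[k] k := π.comp φ with hπR
  have hdec : ∀ r : R, r - algebraMap k R (πR r) ∈ maximalIdeal R := fun r => by
    have hker : RingHom.ker πR ≤ maximalIdeal R :=
      IsLocalRing.le_maximalIdeal (RingHom.ker_ne_top πR)
    exact hker (by simp [RingHom.mem_ker])
  /- `R'` is finite over `k`: `ker φ'` is spanned by the images of generators of `K` -/
  haveI : Module.Finite k R' := by
    obtain ⟨s, hs⟩ := (IsNoetherian.noetherian K : K.FG)
    have hkereq : LinearMap.ker φ'.toLinearMap = Submodule.span k (mk '' (s : Set R)) := by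
      refine le_antisymm ?_ (Submodule.span_le.mpr ?_)
      · intro z hz
        obtain ⟨a, rfl⟩ := Ideal.Quotient.mk_surjective z
        have ha : a ∈ K := hz
        rw [← hs] at ha
        obtain ⟨f, -, hf⟩ := Submodule.mem_span_finset.mp ha
        rw [← hf, map_sum]
        refine Submodule.sum_mem _ fun b hb => ?_
        have hbK : b ∈ K := by
          rw [← hs]
          exact Ideal.subset_span hb
        -- `f b · b ≡ π_R(f b) · b (mod 𝔪 K)`
        have hsplit : f b • b = algebraMap k R (πR (f b)) * b +
            (f b - algebraMap k R (πR (f b))) * b := by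
          rw [smul_eq_mul]; ring
        have hzero : mk ((f b - algebraMap k R (πR (f b))) * b) = 0 :=
          (Ideal.Quotient.eq_zero_iff_mem).mpr (Ideal.mul_mem_mul (hdec (f b)) hbK)
        rw [hsplit, map_add, hzero, add_zero, map_mul, hmk, Ideal.Quotient.mk_algebraMap,
          ← Algebra.smul_def]
        exact Submodule.smul_mem _ _ (Submodule.subset_span ⟨b, hb, rfl⟩)
      · rintro _ ⟨a, ha, rfl⟩
        have haK : a ∈ K := by
          rw [← hs]
          exact Ideal.subset_span ha
        exact haK
    refine Module.finite_def.mpr (Submodule.fg_of_fg_map_of_fg_inf_ker φ'.toLinearMap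
      (IsNoetherian.noetherian _) ?_)
    rw [top_inf_eq, hkereq]
    exact Submodule.fg_span ((s.finite_toSet).image _)
  /- the hypothesis passes to `R'` -/
  have hIR' : (RingHom.ker (π.comp φ)).map mk = RingHom.ker (π.comp φ') := by
    refine le_antisymm (Ideal.map_le_iff_le_comap.mpr fun a ha => ?_) fun z hz => ?_
    · exact ha
    · obtain ⟨a, rfl⟩ := Ideal.Quotient.mk_surjective z
      exact Ideal.mem_map_of_mem mk (hz : a ∈ RingHom.ker (π.comp φ))
  have htr := map_fittingIdeal_le_fittingIdeal_of_map_eq mk (IsNoetherian.noetherian _) hIR'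
  have h' : (Module.fittingIdeal R' (RingHom.ker (π.comp φ')) 0).map φ' ≠ ⊥ := by
    intro h0
    refine h ((Ideal.map_eq_bot_iff_le_ker φ).mpr fun a ha => ?_)
    have h2 : φ' (mk a) ∈ (Module.fittingIdeal R' (RingHom.ker (π.comp φ')) 0).map φ' :=
      Ideal.mem_map_of_mem φ' (htr (Ideal.mem_map_of_mem mk ha))
    rw [h0, Ideal.mem_bot] at h2
    exact h2
  have hinj' := injective_of_map_fittingIdeal_ne_bot_of_finite φ' π hφ'surj h'
  /- `K ≤ 𝔪K`, so `K = 0` by Nakayama -/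
  have hKle : K ≤ maximalIdeal R • K := fun a ha => by
    have : mk a = 0 := hinj' (by rw [hφ'mk, map_zero]; exact ha)
    rw [hmk, Ideal.Quotient.eq_zero_iff_mem] at this
    rwa [Ideal.smul_eq_mul]
  have hK0 : K = ⊥ := Submodule.eq_bot_of_le_smul_of_le_jacobson_bot (maximalIdeal R) K
    (IsNoetherian.noetherian K) hKle (IsLocalRing.maximalIdeal_le_jacobson ⊥)
  exact (RingHom.injective_iff_ker_eq_bot φ).mpr hK0

end Literature.RingTheory.CompleteIntersection
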